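import Summits.BirchSwinnertonDyer.BirchSwinnertonDyer.Theorems.TameQuarticSolventSolventPairLowerBoundSupersingular
import Literature.NumberTheory.EllipticCurves.QuadraticTwistJInvariantProofs
import Literature.NumberTheory.EllipticCurves.QuadraticTwistPadicReduction
import HarnessLib

/-!
# Route `TameQuarticSolvent`, crux `SolventPairLowerBound` (stmt-BirchSwinnertonDyer-21391), line `birth`:
# the TWISTED tame descent — good reduction and `a_w = 0` for a quadratic twist `(W ⊗ L)^{(β)}` at a place
# `w ∋ p` from `p`-adic bounds on the coefficients of `W/ℚ` and the parity `e(w|p)·(…) ≡ ord_w β`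

HONEST FRAMING. Theorems only; helper toward the deciding crux `SolventPairLowerBound` of route
`TameQuarticSolvent` (`--supports stmt-BirchSwinnertonDyer-21391`): the general (any odd `p`) local engine behind
the lead's rung «the K2a constituent `E′ = (E_K)^{(β)}` is good SUPERSINGULAR, `a_𝔭 = 0`, at the prime above `3`»
(companion file `…TwistSupersingular.lean`). The untwisted descents `hasGoodReductionAt_baseChange_of_padicValRat`
(p571347) / `frobeniusTraceAt_baseChange_eq_zero_of_padicValRat` (p581191) are the case `β = 1`. Nothing here is progress on K1⁻/K2a themselves; BSD is not proved by any of this. No route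
file is imported.

WHAT. §1 `valuation_algebraMap_rat_eq` (`ord_w = e(w|p)·ord_p` on `ℚ`), `valuation_four_eq_one`, and
`valuation_algebraMap_b₂_lt`, `…b₄_le`, `…b₆_lt`: `w(b₂) < exp(−M)`, `w(b₄) ≤ exp(−2M)`, `w(b₆) < exp(−3M)`
from `aᵢ = 0 ∨ i·M < 2e·ord_p aᵢ` (`≤` for `i = 4`; ultrametric inequality). §2
`exists_variableChange_quadraticTwist_valuation`: for `w(β) = exp B`, `M = 2m + B`, the rescaled twist
`(ϖ^m, 0, 0, 0) • (W_L)^{(β)}` has `a₁ = a₃ = 0`, `w(a₂) = exp(M)·w(b₂)`, `w(a₄) = exp(2M)·w(b₄)`,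
`w(a₆) = exp(3M)·w(b₆)`, `w(Δ) = exp(6M)·w(Δ(W))`; hence
`frobeniusTraceAt_quadraticTwist_baseChange_eq_zero_of_padicValRat`: GOOD reduction with `a_w = 0` at `w` when
`e·ord_p Δ = 6M`, the bounds hold and `#k_w ≡ 3 (mod 4)` (reduction `y² = x³ + ā₄x`, Ireland–Rosen 18.4 Thm. 5).
Good reduction alone (odd `B`, `b`-form bounds) is the width seat's `…TwistGoodReduction.lean` (p584727); this file
adds supersingularity.

References: J. H. Silverman, *AEC* III.1 Table 3.1, VII.1 (Remark 1.1, Prop. 1.3(b)), VII.5.1(a), X.5 Cor. 5.4,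
C.§16; K. Ireland, M. Rosen, *A Classical Introduction to Modern Number Theory*, Ch. 18 §4 Thm. 5;
J.-P. Serre, J. Tate, Ann. of Math. 88 (1968) §2 Cor. 2.
-/

-- D-0017: single-problem summit, so `Summit.BirchSwinnertonDyer.BirchSwinnertonDyer.…` repeats a namespace BY DESIGN.
set_option linter.dupNamespace false

noncomputable section

open scoped NumberField Classical

open IsDedekindDomain IsDedekindDomain.HeightOneSpectrum NumberField WeierstrassCurve
  Literature.NumberTheory.EllipticCurves Literature.NumberTheory.EllipticCurves.Rank1Residual
  Summit.BirchSwinnertonDyer.Rank1Residual.Additive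

namespace Summit.BirchSwinnertonDyer.BirchSwinnertonDyer.Theorems.SolventPairLowerBound

/-! ## §1 Valuations of rational numbers and of the `b`-invariants at a place above `p` -/

section RatValuation

variable (p : ℕ) [hp : Fact p.Prime] (L : Type) [Field L] [NumberField L] (w : HeightOneSpectrum (𝓞 L))

/-- `ord_w = e(w|p) · ord_p` on `ℚ`: for `x ∈ ℚˣ`, `w(x) = exp(−e(w|p)·ord_p x)` (Mathlib
`IsDedekindDomain.HeightOneSpectrum.valuation_liesOver`). [folklore] -/
theorem valuation_algebraMap_rat_eq (hw : (p : 𝓞 L) ∈ w.asIdeal) {x : ℚ} (hx : x ≠ 0) :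
    w.valuation L (algebraMap ℚ L x) =
      WithZero.exp (-((w.asIdeal.ramificationIdx ℤ : ℤ) * padicValRat p x)) := by
  classical
  set v : HeightOneSpectrum ℤ := (Rat.HeightOneSpectrum.primesEquiv (R := ℤ)).symm ⟨p, hp.out⟩
    with hvdef
  have hv : Rat.HeightOneSpectrum.natGenerator v = p :=
    congrArg Subtype.val ((Rat.HeightOneSpectrum.primesEquiv (R := ℤ)).apply_symm_apply ⟨p, hp.out⟩)
  have hvspan : v.asIdeal = Ideal.span {(p : ℤ)} := by
    rw [Rat.HeightOneSpectrum.asIdeal_eq_span_natGenerator_int, hv]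
  haveI hlies' : w.asIdeal.LiesOver (Ideal.span {(p : ℤ)}) := liesOver_span_of_natCast_mem p L w hw
  haveI hlies : w.asIdeal.LiesOver v.asIdeal := by rw [hvspan]; exact hlies'
  haveI := w.isPrime
  have he' : v.asIdeal.ramificationIdx' w.asIdeal = w.asIdeal.ramificationIdx ℤ := by
    rw [Ideal.ramificationIdx'_eq_ramificationIdx _ _ v.ne_bot]
  rw [← valuation_liesOver (K := ℚ) L v w x, he',
    Rat.HeightOneSpectrum.valuation_eq_exp_neg_padicValRat v hx, hv, ← WithZero.exp_nsmul, nsmul_eq_mul,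
    mul_neg]

/-- At a place above an ODD prime `p`, `w(4) = 1` and `w(2) = 1`. [folklore] -/
theorem valuation_four_eq_one (hw : (p : 𝓞 L) ∈ w.asIdeal) (hp2 : p ≠ 2) :
    w.valuation L (4 : L) = 1 ∧ w.valuation L (2 : L) = 1 := by
  have h2 : padicValRat p (2 : ℚ) = 0 := by
    rw [show (2 : ℚ) = ((2 : ℕ) : ℚ) by norm_num, padicValRat.of_nat, Nat.cast_eq_zero,
      padicValNat.eq_zero_of_not_dvd]
    intro h
    exact hp2 ((Nat.prime_dvd_prime_iff_eq hp.out Nat.prime_two).mp h)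
  have h4 : padicValRat p (4 : ℚ) = 0 := by
    rw [show (4 : ℚ) = 2 * 2 by norm_num, padicValRat.mul (p := p) two_ne_zero two_ne_zero, h2, add_zero]
  refine ⟨?_, ?_⟩
  · have h := valuation_algebraMap_rat_eq p L w hw (x := 4) (by norm_num)
    rw [h4, mul_zero, neg_zero, WithZero.exp_zero] at h
    simpa using h
  · have h := valuation_algebraMap_rat_eq p L w hw (x := 2) (by norm_num)
    rw [h2, mul_zero, neg_zero, WithZero.exp_zero] at h
    simpa using h

variable {p L w}

/-- A rational number `a` with `a = 0` or `c ≤ e(w|p)·ord_p a` has `w(a) ≤ exp(−c)`. [folklore] -/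
theorem valuation_algebraMap_rat_le_exp (hw : (p : 𝓞 L) ∈ w.asIdeal) {e : ℕ}
    (he : w.asIdeal.ramificationIdx ℤ = e) {a : ℚ} {c : ℤ} (h : a = 0 ∨ c ≤ e * padicValRat p a) :
    w.valuation L (algebraMap ℚ L a) ≤ WithZero.exp (-c) := by
  rcases eq_or_ne a 0 with rfl | ha0
  · rw [map_zero, map_zero]; exact zero_le
  rw [valuation_algebraMap_rat_eq p L w hw ha0, he, WithZero.exp_le_exp]
  rcases h with h | h
  · exact absurd h ha0
  · linarith

/-- A rational number `a` with `a = 0` or `c < e(w|p)·ord_p a` has `w(a) < exp(−c)`. [folklore] -/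
theorem valuation_algebraMap_rat_lt_exp (hw : (p : 𝓞 L) ∈ w.asIdeal) {e : ℕ}
    (he : w.asIdeal.ramificationIdx ℤ = e) {a : ℚ} {c : ℤ} (h : a = 0 ∨ c < e * padicValRat p a) :
    w.valuation L (algebraMap ℚ L a) < WithZero.exp (-c) := by
  rcases eq_or_ne a 0 with rfl | ha0
  · rw [map_zero, map_zero]; exact WithZero.zero_lt_coe _
  rw [valuation_algebraMap_rat_eq p L w hw ha0, he, WithZero.exp_lt_exp]
  rcases h with h | h
  · exact absurd h ha0
  · linarith

/-- A rational number `a` with `a = 0` or `c < 2e(w|p)·ord_p a` has `w(a)² < exp(−c)`. [folklore] -/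
theorem valuation_algebraMap_rat_sq_lt_exp (hw : (p : 𝓞 L) ∈ w.asIdeal) {e : ℕ}
    (he : w.asIdeal.ramificationIdx ℤ = e) {a : ℚ} {c : ℤ} (h : a = 0 ∨ c < 2 * e * padicValRat p a) :
    w.valuation L (algebraMap ℚ L a) ^ 2 < WithZero.exp (-c) := by
  rcases eq_or_ne a 0 with rfl | ha0
  · rw [map_zero, map_zero, zero_pow two_ne_zero]; exact WithZero.zero_lt_coe _
  rw [valuation_algebraMap_rat_eq p L w hw ha0, he, ← WithZero.exp_nsmul, WithZero.exp_lt_exp]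
  rcases h with h | h
  · exact absurd h ha0
  · simp only [nsmul_eq_mul]; push_cast; linarith

variable (W : WeierstrassCurve ℚ)

/-- **`w(b₂) < exp(−M)`** from the STRICT bounds `a₁ = 0 ∨ M < 2e·ord_p a₁`, `a₂ = 0 ∨ 2M < 2e·ord_p a₂`.
[folklore] -/
theorem valuation_algebraMap_b₂_lt (hw : (p : 𝓞 L) ∈ w.asIdeal) (hp2 : p ≠ 2) {e : ℕ}
    (he : w.asIdeal.ramificationIdx ℤ = e) {M : ℤ}
    (h₁ : W.a₁ = 0 ∨ M < 2 * e * padicValRat p W.a₁) (h₂ : W.a₂ = 0 ∨ 2 * M < 2 * e * padicValRat p W.a₂) :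
    w.valuation L (algebraMap ℚ L W.b₂) < WithZero.exp (-M) := by
  have h4 := (valuation_four_eq_one p L w hw hp2).1
  have hb : algebraMap ℚ L W.b₂ = (algebraMap ℚ L W.a₁) ^ 2 + 4 * algebraMap ℚ L W.a₂ := by
    simp only [WeierstrassCurve.b₂, map_add, map_pow, map_mul, map_ofNat]
  rw [hb]
  refine (Valuation.map_add _ _ _).trans_lt (max_lt ?_ ?_)
  · rw [map_pow]; exact valuation_algebraMap_rat_sq_lt_exp hw he h₁
  · rw [map_mul, h4, one_mul]
    exact valuation_algebraMap_rat_lt_exp hw he (h₂.imp id fun h ↦ by linarith)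

/-- **`w(b₄) ≤ exp(−2M)`** from `a₁ = 0 ∨ M ≤ 2e·ord_p a₁`, `a₃ = 0 ∨ 3M ≤ 2e·ord_p a₃`,
`a₄ = 0 ∨ 4M ≤ 2e·ord_p a₄` (`b₄ = 2a₄ + a₁a₃`, `p` odd). [folklore] -/
theorem valuation_algebraMap_b₄_le (hw : (p : 𝓞 L) ∈ w.asIdeal) (hp2 : p ≠ 2) {e : ℕ}
    (he : w.asIdeal.ramificationIdx ℤ = e) {M : ℤ}
    (h₁ : W.a₁ = 0 ∨ M ≤ 2 * e * padicValRat p W.a₁) (h₃ : W.a₃ = 0 ∨ 3 * M ≤ 2 * e * padicValRat p W.a₃)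
    (h₄ : W.a₄ = 0 ∨ 4 * M ≤ 2 * e * padicValRat p W.a₄) :
    w.valuation L (algebraMap ℚ L W.b₄) ≤ WithZero.exp (-(2 * M)) := by
  have h2 := (valuation_four_eq_one p L w hw hp2).2
  have hb : algebraMap ℚ L W.b₄ = 2 * algebraMap ℚ L W.a₄ + algebraMap ℚ L W.a₁ * algebraMap ℚ L W.a₃ := by
    simp only [WeierstrassCurve.b₄, map_add, map_mul, map_ofNat]
  rw [hb]
  refine (Valuation.map_add _ _ _).trans (max_le ?_ ?_)
  · rw [map_mul, h2, one_mul]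
    exact valuation_algebraMap_rat_le_exp hw he (h₄.imp id fun h ↦ by linarith)
  · rw [map_mul]
    rcases eq_or_ne W.a₁ 0 with h0 | ha₁
    · rw [h0, map_zero, map_zero, zero_mul]; exact zero_le
    rcases eq_or_ne W.a₃ 0 with h0 | ha₃
    · rw [h0, map_zero, map_zero, mul_zero]; exact zero_le
    have h₁' : M ≤ 2 * e * padicValRat p W.a₁ := h₁.resolve_left ha₁
    have h₃' : 3 * M ≤ 2 * e * padicValRat p W.a₃ := h₃.resolve_left ha₃
    rw [valuation_algebraMap_rat_eq p L w hw ha₁, valuation_algebraMap_rat_eq p L w hw ha₃, he,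
      ← WithZero.exp_add, WithZero.exp_le_exp]
    linarith

/-- **`w(b₆) < exp(−3M)`** from the STRICT bounds `a₃ = 0 ∨ 3M < 2e·ord_p a₃`, `a₆ = 0 ∨ 6M < 2e·ord_p a₆`.
[folklore] -/
theorem valuation_algebraMap_b₆_lt (hw : (p : 𝓞 L) ∈ w.asIdeal) (hp2 : p ≠ 2) {e : ℕ}
    (he : w.asIdeal.ramificationIdx ℤ = e) {M : ℤ}
    (h₃ : W.a₃ = 0 ∨ 3 * M < 2 * e * padicValRat p W.a₃) (h₆ : W.a₆ = 0 ∨ 6 * M < 2 * e * padicValRat p W.a₆) :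
    w.valuation L (algebraMap ℚ L W.b₆) < WithZero.exp (-(3 * M)) := by
  have h4 := (valuation_four_eq_one p L w hw hp2).1
  have hb : algebraMap ℚ L W.b₆ = (algebraMap ℚ L W.a₃) ^ 2 + 4 * algebraMap ℚ L W.a₆ := by
    simp only [WeierstrassCurve.b₆, map_add, map_pow, map_mul, map_ofNat]
  rw [hb]
  refine (Valuation.map_add _ _ _).trans_lt (max_lt ?_ ?_)
  · rw [map_pow]; exact valuation_algebraMap_rat_sq_lt_exp hw he h₃
  · rw [map_mul, h4, one_mul]
    exact valuation_algebraMap_rat_lt_exp hw he (h₆.imp id fun h ↦ by linarith)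

end RatValuation

/-! ## §2 The twisted tame descent -/

section TwistDescent

variable {L : Type} [Field L] [NumberField L] (w : HeightOneSpectrum (𝓞 L))

/-- **The rescaled twisted model.** Let `W/ℚ`, `L` a number field, `w ∋ p` with `p` odd, `β ∈ L` with
`w(β) = exp B` and `M ≡ B (mod 2)`, say `M = 2m + B`. With `ϖ` a `w`-uniformiser, the change of variables
`(ϖ^m, 0, 0, 0)` carries the twist `(W_L)^{(β)} = ⟨0, β b₂/4, 0, β² b₄/2, β³ b₆/4⟩` to a model `Z` with
`a₁(Z) = a₃(Z) = 0`, `w(a₂(Z)) = exp(M)·w(b₂)`, `w(a₄(Z)) = exp(2M)·w(b₄)`, `w(a₆(Z)) = exp(3M)·w(b₆)` and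
`w(Δ(Z)) = exp(6M)·w(Δ(W))` (Silverman *AEC* III.1 Table 3.1, X.5: `Δ(W^{(β)}) = β⁶ Δ(W)`). [folklore] -/
theorem exists_variableChange_quadraticTwist_valuation (p : ℕ) [Fact p.Prime] (hp2 : p ≠ 2)
    (hw : (p : 𝓞 L) ∈ w.asIdeal) (W : WeierstrassCurve ℚ) (β : L) {M B : ℤ}
    (hβ : w.valuation L β = WithZero.exp B) (hMB : ∃ m : ℤ, M = 2 * m + B) :
    ∃ C : VariableChange L,
      (C • (W.baseChange L).quadraticTwist β).a₁ = 0 ∧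
      (C • (W.baseChange L).quadraticTwist β).a₃ = 0 ∧
      w.valuation L (C • (W.baseChange L).quadraticTwist β).a₂ =
        WithZero.exp M * w.valuation L (algebraMap ℚ L W.b₂) ∧
      w.valuation L (C • (W.baseChange L).quadraticTwist β).a₄ =
        WithZero.exp (2 * M) * w.valuation L (algebraMap ℚ L W.b₄) ∧
      w.valuation L (C • (W.baseChange L).quadraticTwist β).a₆ =
        WithZero.exp (3 * M) * w.valuation L (algebraMap ℚ L W.b₆) ∧
      w.valuation L (C • (W.baseChange L).quadraticTwist β).Δ =
        WithZero.exp (6 * M) * w.valuation L (algebraMap ℚ L W.Δ) := by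
  classical
  obtain ⟨m, hm⟩ := hMB
  obtain ⟨h4, h2⟩ := valuation_four_eq_one p L w hw hp2
  haveI : NeZero (2 : L) := ⟨two_ne_zero⟩
  -- a `w`-uniformiser and the rescaling unit `ϖ ^ m`
  obtain ⟨ϖ, hϖ⟩ := w.valuation_exists_uniformizer L
  have hϖ0 : ϖ ≠ 0 := by
    intro h0; rw [h0, map_zero] at hϖ; exact WithZero.exp_ne_zero hϖ.symm
  set U : Lˣ := (Units.mk0 ϖ hϖ0) ^ m with hU
  set C : VariableChange L := ⟨U, 0, 0, 0⟩ with hC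
  set T := (W.baseChange L).quadraticTwist β with hT
  set Z := C • T with hZ
  have hCu : (↑C.u⁻¹ : L) = ϖ ^ (-m) := by
    simp only [hC, hU, ← zpow_neg, Units.val_zpow_eq_zpow_val, Units.val_mk0]
  have hvu : ∀ i : ℕ, w.valuation L ((↑C.u⁻¹ : L) ^ i) = WithZero.exp ((i : ℤ) * m) := fun i ↦ by
    rw [hCu, map_pow, map_zpow₀, hϖ, ← WithZero.exp_zsmul, ← WithZero.exp_nsmul]
    congr 1
    simp only [smul_eq_mul, nsmul_eq_mul, mul_neg, mul_one, neg_neg]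
  have hvβ : ∀ j : ℕ, w.valuation L (β ^ j) = WithZero.exp ((j : ℤ) * B) := fun j ↦ by
    rw [map_pow, hβ, ← WithZero.exp_nsmul, nsmul_eq_mul]
  -- the coefficients of `Z`
  have hZa₁ : Z.a₁ = 0 := by
    rw [hZ, variableChange_a₁]; simp [hC, hT]
  have hZa₃ : Z.a₃ = 0 := by
    rw [hZ, variableChange_a₃]; simp [hC, hT]
  have hZa₂ : Z.a₂ = (↑C.u⁻¹ : L) ^ 2 * (β * algebraMap ℚ L W.b₂ / 4) := by
    rw [hZ, variableChange_a₂]; simp [hC, hT, WeierstrassCurve.baseChange]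
  have hZa₄ : Z.a₄ = (↑C.u⁻¹ : L) ^ 4 * (β ^ 2 * algebraMap ℚ L W.b₄ / 2) := by
    rw [hZ, variableChange_a₄]; simp [hC, hT, WeierstrassCurve.baseChange]
  have hZa₆ : Z.a₆ = (↑C.u⁻¹ : L) ^ 6 * (β ^ 3 * algebraMap ℚ L W.b₆ / 4) := by
    rw [hZ, variableChange_a₆]; simp [hC, hT, WeierstrassCurve.baseChange]
  have hZΔ : Z.Δ = (↑C.u⁻¹ : L) ^ 12 * (β ^ 6 * algebraMap ℚ L W.Δ) := by
    rw [hZ, variableChange_Δ, hT, quadraticTwist_Δ, WeierstrassCurve.baseChange, map_Δ]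
  refine ⟨C, hZa₁, hZa₃, ?_, ?_, ?_, ?_⟩
  · rw [hZa₂, map_mul, map_div₀, map_mul, hvu, h4, div_one, hβ, ← mul_assoc, ← WithZero.exp_add]
    congr 2; rw [hm]; push_cast; ring
  · rw [hZa₄, map_mul, map_div₀, map_mul, hvu, h2, div_one, hvβ, ← mul_assoc, ← WithZero.exp_add]
    congr 2; rw [hm]; push_cast; ring
  · rw [hZa₆, map_mul, map_div₀, map_mul, hvu, h4, div_one, hvβ, ← mul_assoc, ← WithZero.exp_add]
    congr 2; rw [hm]; push_cast; ring
  · rw [hZΔ, map_mul, map_mul, hvu, hvβ, ← mul_assoc, ← WithZero.exp_add]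
    congr 2; rw [hm]; push_cast; ring

/-- **Twisted tame descent: good SUPERSINGULAR reduction, `a_w = 0`.** Let `W/ℚ` be elliptic, `p` an odd
prime, `e : ℕ`, `M B : ℤ` with `e · ord_p Δ(W) = 6M`, `aᵢ(W) = 0` or `i·M < 2e · ord_p aᵢ(W)` for `i = 1, 2, 3, 6`,
and `a₄(W) = 0` or `4M ≤ 2e · ord_p a₄(W)`. Then for every number field `L`, place `w ∋ p` with `e(w|p) = e` and
`#k_w ≡ 3 (mod 4)`, and `β ∈ L` with `w(β) = exp B`, `B ≡ M (mod 2)`: the twist `(W ⊗ L)^{(β)}` has GOOD reduction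
at `w` with `a_w = 0`. The rescaled twisted model (`exists_variableChange_quadraticTwist_valuation`, §1 bounds)
has `a₁ = a₃ = 0`, `w(a₂), w(a₆) < 1`, `w(a₄) ≤ 1` and unit discriminant, so it reduces to `y² = x³ + ā₄x`,
which has `#k_w + 1` points (Ireland–Rosen Ch. 18 §4 Thm. 5; landed `frobeniusTraceAt_eq_zero_of_valuation_lt_one`);
good reduction and `a_w` are invariant under the change of variables (Silverman VII.1.3(b), VII.5.1(a), C.§16).
(Good reduction alone, under the non-strict bounds in `b`-form and odd `B`, is the sibling
`hasGoodReductionAt_quadraticTwist_baseChange_of_padicValRat` of `…TwistGoodReduction.lean`, p584727.)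
[cite: IrelandRosen1990, Ch. 18 §4, Theorem 5] [cite: SilvermanAEC2009, VII.1 Prop. 1.3(b), VII.5.1(a) and C.§16] -/
theorem frobeniusTraceAt_quadraticTwist_baseChange_eq_zero_of_padicValRat (W : WeierstrassCurve ℚ)
    [W.IsElliptic] (p : ℕ) [hp : Fact p.Prime] (hp2 : p ≠ 2) {e : ℕ} {M B : ℤ}
    (hΔ : (e : ℤ) * padicValRat p W.Δ = 6 * M)
    (h₁ : W.a₁ = 0 ∨ M < 2 * e * padicValRat p W.a₁)
    (h₂ : W.a₂ = 0 ∨ 2 * M < 2 * e * padicValRat p W.a₂)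
    (h₃ : W.a₃ = 0 ∨ 3 * M < 2 * e * padicValRat p W.a₃)
    (h₄ : W.a₄ = 0 ∨ 4 * M ≤ 2 * e * padicValRat p W.a₄)
    (h₆ : W.a₆ = 0 ∨ 6 * M < 2 * e * padicValRat p W.a₆)
    (w : HeightOneSpectrum (𝓞 L)) (hw : (p : 𝓞 L) ∈ w.asIdeal) (he : w.asIdeal.ramificationIdx ℤ = e)
    (hq : Nat.card (𝓞 L ⧸ w.asIdeal) % 4 = 3)
    (β : L) (hβ : w.valuation L β = WithZero.exp B) (hMB : ∃ m : ℤ, M = 2 * m + B) :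
    ((W.baseChange L).quadraticTwist β).HasGoodReductionAt w ∧
      ((W.baseChange L).quadraticTwist β).frobeniusTraceAt w = 0 := by
  obtain ⟨C, ha₁, ha₃, ha₂, ha₄, ha₆, hΔ'⟩ :=
    exists_variableChange_quadraticTwist_valuation w p hp2 hw W β hβ hMB
  have hβ0 : β ≠ 0 := by
    intro h0; rw [h0, map_zero] at hβ; exact WithZero.exp_ne_zero hβ.symm
  haveI : NeZero (2 : L) := ⟨two_ne_zero⟩
  haveI : (W.baseChange L).IsElliptic := by
    rw [WeierstrassCurve.baseChange]; infer_instance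
  haveI hT : ((W.baseChange L).quadraticTwist β).IsElliptic := isElliptic_quadraticTwist _ hβ0
  set T := (W.baseChange L).quadraticTwist β with hTdef
  set Z := C • T with hZ
  haveI : Z.IsElliptic := by rw [hZ]; infer_instance
  have hone : ∀ c : ℤ, WithZero.exp c * WithZero.exp (-c) = 1 := fun c ↦ by
    rw [← WithZero.exp_add, add_neg_cancel, WithZero.exp_zero]
  have h₁' : W.a₁ = 0 ∨ M ≤ 2 * e * padicValRat p W.a₁ := h₁.imp id le_of_lt
  have h₃' : W.a₃ = 0 ∨ 3 * M ≤ 2 * e * padicValRat p W.a₃ := h₃.imp id le_of_lt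
  have hZ₂ : w.valuation L Z.a₂ < 1 := by
    rw [ha₂, ← hone M]
    exact mul_lt_mul_of_pos_left (valuation_algebraMap_b₂_lt W hw hp2 he h₁ h₂) (zero_lt_iff.mpr WithZero.exp_ne_zero)
  have hZ₄ : w.valuation L Z.a₄ ≤ 1 := by
    rw [ha₄, ← hone (2 * M)]
    exact mul_le_mul_right (valuation_algebraMap_b₄_le W hw hp2 he h₁' h₃' h₄) _
  have hZ₆ : w.valuation L Z.a₆ < 1 := by
    rw [ha₆, ← hone (3 * M)]
    exact mul_lt_mul_of_pos_left (valuation_algebraMap_b₆_lt W hw hp2 he h₃ h₆) (zero_lt_iff.mpr WithZero.exp_ne_zero)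
  have hZΔ : w.valuation L Z.Δ = 1 := by
    rw [hΔ', valuation_algebraMap_rat_eq p L w hw W.isUnit_Δ.ne_zero, he, ← WithZero.exp_add,
      ← WithZero.exp_zero]
    congr 1; linarith
  have hZ₁ : w.valuation L Z.a₁ < 1 := by rw [ha₁, map_zero]; exact zero_lt_one
  have hZ₃ : w.valuation L Z.a₃ < 1 := by rw [ha₃, map_zero]; exact zero_lt_one
  have hgoodZ : Z.HasGoodReductionAt w :=
    Z.hasGoodReductionAt_of_valuation_le_one_of_valuation_Δ_eq_one w hZ₁.le hZ₂.le hZ₃.le hZ₄ hZ₆.le hZΔ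
  have hgood : T.HasGoodReductionAt w := (hasGoodReductionAt_smul_iff_holds w T C).mp (by rw [← hZ]; exact hgoodZ)
  refine ⟨hgood, ?_⟩
  rw [← WeierstrassCurve.frobeniusTraceAt_smul T C w hgood, ← hZ]
  exact frobeniusTraceAt_eq_zero_of_valuation_lt_one Z w hZ₁ hZ₂ hZ₃ hZ₄ hZ₆ hZΔ hq

end TwistDescent

end Summit.BirchSwinnertonDyer.BirchSwinnertonDyer.Theorems.SolventPairLowerBound

end
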